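import Mathlib
import Summits.Ventures.HodgeRepro.Tier4.Line1.IsotypicBernstein

/-!
# Tier4/Line1/IsotypicBernsteinIso — THE BERNSTEIN MAP IS AN INTERTWINER, and an isomorphism of fixed blocks gives
an isomorphism of the algebraic cores; (C2) `hnon` from multiplicity one of the cores

Blind re-derivation cell `pub-hodge-repro`, Tier 4 (README §9–§10), seat t4-L1-p2 (gen 4), LINE L1; the closing
module of the cut (C2-BERNSTEIN) (S14153, plan-1 YES S14157).  Target tree path
`lean/Summits/Ventures/HodgeRepro/Tier4/Line1/IsotypicBernsteinIso.lean`.  Imports this seat's `IsotypicBernstein`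
(`core`, `coreGen`, `coreL`, `range_coreL`, `bern`, `bern_R`, `bern_add`, `bern_smul`, `bern_zero`,
`bern_mem_core`, `isInvariantSubspace_core`, `core_subset`) and through it `IsotypicC2` (`IsIntertwiner`,
`IsIsoRep`, `IsoRep`), `GeneratedSubspace` (`R_R_eq_R_conv`, `R_rightTranslate`, `IsTest.leftTranslate`,
`R_add'`, `R_smul'`, `R_zero'`) and p2 g0's `ConvTest` (`conv_isTest`).  0 print.

WHAT IS PROVED.  `isIntertwiner_bern`: for `θ : W i →ₗ[H] W j` the Bernstein map `bern θ` is an intertwiner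
`core W i → core W j` — it commutes with right translation (`bern_right`: on a generator,
`(R(f) w)(· g) = R(f(g⁻¹ ·)) w` by `R_rightTranslate`, and `bern θ` sends it to `R(f(g⁻¹ ·)) (θ w) = (R(f) (θ w))(· g)`)
and with every `R(f)` (`bern_conv`: `R(f) (R(f') w) = R(f ⋆ f') w` by the composition law), both extended from the
generators by `Submodule.span_induction` with `bern_add` / `bern_smul`.  `isIsoRep_bern`: for an isomorphism
`θ : W i ≃ₗ[H] W j`, `bern θ` and `bern θ.symm` are mutually inverse on the cores (on generators
`R(f) (θ.symm (θ w)) = R(f) w`).  THEOREMS `isoRep_core_of_linearEquiv : W i ≃ₗ[H] W j → IsoRep (core W i) (core W j)`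
(the fixed-vector functor REFLECTS isomorphism on the algebraic cores — Bernstein, the kernel-checkable half),
`reflectsIso_core`, and the (C2) corollary **`hnon_of_multiplicityOne_core`**: under the displayed `hfull`
(BlockSimple's clause) and the irreducibility of the constituents, MULTIPLICITY ONE of the cores
(`i ≠ j → ¬ IsoRep (core (W i)) (core (W j))`) gives the field `hnon : ∀ i j, i ≠ j → IsEmpty (W i ≃ₗ[H] W j)` of
p5's `IdempotentData` / `HeckeBlockW`.

NOT claimed: `τ (idx i) ≅ τ (idx j)` on the closures; multiplicity one itself (DATA of the route).  Nothing here
says anything about the status of the Hodge conjecture for CM abelian varieties, which is NOT proved (HC_CM is NOT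
proved by anyone in this repository).
-/

set_option autoImplicit false

noncomputable section

namespace Summit.Ventures.HodgeRepro.Tier4.Line1

open MeasureTheory Topology

namespace RTF

namespace Setting

variable {G : Type} [Group G] [TopologicalSpace G] [IsTopologicalGroup G] [MeasurableSpace G] [BorelSpace G]
  (S : Setting G)

section Iso

variable {H : Type} [Ring H] {Vb : Submodule ℂ (G → ℂ)} [Module H Vb] {e : G → ℂ} {tst : H → G → ℂ}
  (he : IsTest e) (hVb : ∀ ψ : G → ℂ, ψ ∈ Vb ↔ S.Invariant ψ ∧ Continuous ψ ∧ S.R e ψ = ψ)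
  (hact : ∀ (r : H) (ψ : Vb), ((r • ψ : Vb) : G → ℂ) = S.R (tst r) ψ)
  (hfull : ∀ f : G → ℂ, IsTest f → ∃ r : H, ∀ ψ ∈ Vb, S.R e (S.R f ψ) = S.R (tst r) ψ)
  {Vi Vj : Set (G → ℂ)} (hinvi : S.IsInvariantSubspace Vi) (hinvj : S.IsInvariantSubspace Vj)
  (hirrj : S.IsIrreducible Vj) {Wi Wj : Submodule H Vb} (hWi : ∀ ψ : Vb, ψ ∈ Wi ↔ (ψ : G → ℂ) ∈ Vi)
  (hWj : ∀ ψ : Vb, ψ ∈ Wj ↔ (ψ : G → ℂ) ∈ Vj)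
  [SecondCountableTopology G] [T2Space G] [MeasurableMul G] [SFinite S.μ] [LocallyCompactSpace G]

omit [SecondCountableTopology G] [T2Space G] [MeasurableMul G] [SFinite S.μ] [LocallyCompactSpace G] in
include hVb in
/-- the core is the span of the generators. -/
theorem core_eq_span (W : Submodule H Vb) : S.core W = Submodule.span ℂ (Set.range (S.coreGen W)) := by
  rw [← S.range_coreL hVb W, coreL, Finsupp.range_linearCombination]

omit [SecondCountableTopology G] [T2Space G] [MeasurableMul G] [SFinite S.μ] [LocallyCompactSpace G] in
include hVb in
/-- membership in the core is membership in the range of the generator map. -/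
theorem mem_range_coreL_of_mem_core {W : Submodule H Vb} {ψ : G → ℂ} (h : ψ ∈ S.core W) :
    ψ ∈ LinearMap.range (S.coreL W) := by
  rw [S.range_coreL hVb W]
  exact h

include he hVb hact hfull hinvi hinvj hirrj hWi hWj in
/-- **`bern` commutes with right translation** on the core. -/
theorem bern_right (θ : Wi →ₗ[H] Wj) {ψ : G → ℂ} (hψ : ψ ∈ S.core Wi) (g : G) :
    S.bern he hVb hact hfull hinvj hirrj hWj θ (fun x => ψ (x * g)) =
      fun x => S.bern he hVb hact hfull hinvj hirrj hWj θ ψ (x * g) := by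
  have hcore := S.isInvariantSubspace_core hinvi hWi
  have hmem : ∀ {φ : G → ℂ}, φ ∈ S.core Wi → φ ∈ LinearMap.range (S.coreL Wi) :=
    fun h => S.mem_range_coreL_of_mem_core hVb h
  have hψ' : ψ ∈ Submodule.span ℂ (Set.range (S.coreGen Wi)) := by
    rw [← S.core_eq_span hVb Wi]
    exact hψ
  refine Submodule.span_induction (p := fun ψ _ => S.bern he hVb hact hfull hinvj hirrj hWj θ (fun x => ψ (x * g)) =
    fun x => S.bern he hVb hact hfull hinvj hirrj hWj θ ψ (x * g)) ?_ ?_ ?_ ?_ hψ'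
  · rintro _ ⟨p, rfl⟩
    show S.bern he hVb hact hfull hinvj hirrj hWj θ (fun x => S.R p.1.1 ((p.1.2 : Vb) : G → ℂ) (x * g)) =
      fun x => S.bern he hVb hact hfull hinvj hirrj hWj θ (S.R p.1.1 ((p.1.2 : Vb) : G → ℂ)) (x * g)
    rw [S.R_rightTranslate, S.bern_R he hVb hact hfull hinvj hirrj hWj θ (IsTest.leftTranslate p.2 g),
      S.bern_R he hVb hact hfull hinvj hirrj hWj θ p.2, S.R_rightTranslate]
  · show S.bern he hVb hact hfull hinvj hirrj hWj θ (0 : G → ℂ) =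
      fun x => S.bern he hVb hact hfull hinvj hirrj hWj θ (0 : G → ℂ) (x * g)
    rw [S.bern_zero he hVb hact hfull hinvj hirrj hWj θ]
    rfl
  · intro x y hx hy hx' hy'
    have hxc : x ∈ S.core Wi := by rw [S.core_eq_span hVb Wi]; exact hx
    have hyc : y ∈ S.core Wi := by rw [S.core_eq_span hVb Wi]; exact hy
    have h1 : (fun t => (x + y) (t * g)) = (fun t => x (t * g)) + fun t => y (t * g) := rfl
    rw [h1, S.bern_add he hVb hact hfull hinvj hirrj hWj θ (hmem (hcore.right x hxc g)) (hmem (hcore.right y hyc g)),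
      hx', hy', S.bern_add he hVb hact hfull hinvj hirrj hWj θ (hmem hxc) (hmem hyc)]
    rfl
  · intro c x hx hx'
    have hxc : x ∈ S.core Wi := by rw [S.core_eq_span hVb Wi]; exact hx
    have h1 : (fun t => (c • x) (t * g)) = c • fun t => x (t * g) := rfl
    rw [h1, S.bern_smul he hVb hact hfull hinvj hirrj hWj θ (hmem (hcore.right x hxc g)), hx',
      S.bern_smul he hVb hact hfull hinvj hirrj hWj θ (hmem hxc)]
    rfl

include he hVb hact hfull hinvi hinvj hirrj hWi hWj in
/-- **`bern` commutes with every `R(f)`** on the core (the composition law on the generators). -/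
theorem bern_conv (θ : Wi →ₗ[H] Wj) {ψ : G → ℂ} (hψ : ψ ∈ S.core Wi) {f : G → ℂ} (hf : IsTest f) :
    S.bern he hVb hact hfull hinvj hirrj hWj θ (S.R f ψ) = S.R f (S.bern he hVb hact hfull hinvj hirrj hWj θ ψ) := by
  have hcore := S.isInvariantSubspace_core hinvi hWi
  have hsubi := S.core_subset hinvi hWi
  have hsubj := S.core_subset hinvj hWj
  have hmem : ∀ {φ : G → ℂ}, φ ∈ S.core Wi → φ ∈ LinearMap.range (S.coreL Wi) :=
    fun h => S.mem_range_coreL_of_mem_core hVb h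
  have hψ' : ψ ∈ Submodule.span ℂ (Set.range (S.coreGen Wi)) := by
    rw [← S.core_eq_span hVb Wi]
    exact hψ
  refine Submodule.span_induction (p := fun ψ _ => S.bern he hVb hact hfull hinvj hirrj hWj θ (S.R f ψ) =
    S.R f (S.bern he hVb hact hfull hinvj hirrj hWj θ ψ)) ?_ ?_ ?_ ?_ hψ'
  · rintro _ ⟨p, rfl⟩
    have hwc : Continuous ((p.1.2 : Vb) : G → ℂ) := ((hVb _).1 (p.1.2 : Vb).2).2.1
    have hθc : Continuous ((θ p.1.2 : Vb) : G → ℂ) := ((hVb _).1 (θ p.1.2 : Vb).2).2.1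
    show S.bern he hVb hact hfull hinvj hirrj hWj θ (S.R f (S.R p.1.1 ((p.1.2 : Vb) : G → ℂ))) =
      S.R f (S.bern he hVb hact hfull hinvj hirrj hWj θ (S.R p.1.1 ((p.1.2 : Vb) : G → ℂ)))
    rw [S.R_R_eq_R_conv hf p.2 hwc, S.bern_R he hVb hact hfull hinvj hirrj hWj θ (S.conv_isTest hf p.2).1,
      S.bern_R he hVb hact hfull hinvj hirrj hWj θ p.2, S.R_R_eq_R_conv hf p.2 hθc]
  · rw [S.R_zero', S.bern_zero he hVb hact hfull hinvj hirrj hWj θ, S.R_zero']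
  · intro x y hx hy hx' hy'
    have hxc : x ∈ S.core Wi := by rw [S.core_eq_span hVb Wi]; exact hx
    have hyc : y ∈ S.core Wi := by rw [S.core_eq_span hVb Wi]; exact hy
    rw [S.R_add' hf (hinvi.cont x (hsubi hxc)) (hinvi.cont y (hsubi hyc)),
      S.bern_add he hVb hact hfull hinvj hirrj hWj θ (hmem (hcore.conv x hxc f hf)) (hmem (hcore.conv y hyc f hf)),
      hx', hy', S.bern_add he hVb hact hfull hinvj hirrj hWj θ (hmem hxc) (hmem hyc),
      S.R_add' hf (hinvj.cont _ (hsubj (S.bern_mem_core he hVb hact hfull hinvj hirrj hWj θ (hmem hxc))))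
        (hinvj.cont _ (hsubj (S.bern_mem_core he hVb hact hfull hinvj hirrj hWj θ (hmem hyc))))]
  · intro c x hx hx'
    have hxc : x ∈ S.core Wi := by rw [S.core_eq_span hVb Wi]; exact hx
    rw [S.R_smul', S.bern_smul he hVb hact hfull hinvj hirrj hWj θ (hmem (hcore.conv x hxc f hf)), hx',
      S.bern_smul he hVb hact hfull hinvj hirrj hWj θ (hmem hxc), S.R_smul']

include he hVb hact hfull hinvi hinvj hirrj hWi hWj in
/-- **the Bernstein map is an intertwiner** `core W i → core W j`. -/
theorem isIntertwiner_bern (θ : Wi →ₗ[H] Wj) :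
    S.IsIntertwiner (S.core Wi) (S.core Wj) (S.bern he hVb hact hfull hinvj hirrj hWj θ) where
  maps ψ hψ := S.bern_mem_core he hVb hact hfull hinvj hirrj hWj θ (S.mem_range_coreL_of_mem_core hVb hψ)
  add ψ hψ ψ' hψ' := by
    show S.bern he hVb hact hfull hinvj hirrj hWj θ (ψ + ψ') =
      S.bern he hVb hact hfull hinvj hirrj hWj θ ψ + S.bern he hVb hact hfull hinvj hirrj hWj θ ψ'
    exact S.bern_add he hVb hact hfull hinvj hirrj hWj θ (S.mem_range_coreL_of_mem_core hVb hψ)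
      (S.mem_range_coreL_of_mem_core hVb hψ')
  smul ψ hψ c := by
    show S.bern he hVb hact hfull hinvj hirrj hWj θ (c • ψ) = c • S.bern he hVb hact hfull hinvj hirrj hWj θ ψ
    exact S.bern_smul he hVb hact hfull hinvj hirrj hWj θ (S.mem_range_coreL_of_mem_core hVb hψ) c
  right ψ hψ g := S.bern_right he hVb hact hfull hinvi hinvj hirrj hWi hWj θ hψ g
  conv ψ hψ f hf := S.bern_conv he hVb hact hfull hinvi hinvj hirrj hWi hWj θ hψ hf

include he hVb hact hfull hinvi hinvj hirrj hWi hWj in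
/-- **`bern θ.symm ∘ bern θ = id` on the core** for an isomorphism `θ`. -/
theorem bern_symm_bern (hirri : S.IsIrreducible Vi) (θ : Wi ≃ₗ[H] Wj) {ψ : G → ℂ} (hψ : ψ ∈ S.core Wi) :
    S.bern he hVb hact hfull hinvi hirri hWi θ.symm.toLinearMap
      (S.bern he hVb hact hfull hinvj hirrj hWj θ.toLinearMap ψ) = ψ := by
  have hmemi : ∀ {φ : G → ℂ}, φ ∈ S.core Wi → φ ∈ LinearMap.range (S.coreL Wi) :=
    fun h => S.mem_range_coreL_of_mem_core hVb h
  have hmemj : ∀ {φ : G → ℂ}, φ ∈ S.core Wj → φ ∈ LinearMap.range (S.coreL Wj) :=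
    fun h => S.mem_range_coreL_of_mem_core hVb h
  have hψ' : ψ ∈ Submodule.span ℂ (Set.range (S.coreGen Wi)) := by
    rw [← S.core_eq_span hVb Wi]
    exact hψ
  refine Submodule.span_induction (p := fun ψ _ => S.bern he hVb hact hfull hinvi hirri hWi θ.symm.toLinearMap
    (S.bern he hVb hact hfull hinvj hirrj hWj θ.toLinearMap ψ) = ψ) ?_ ?_ ?_ ?_ hψ'
  · rintro _ ⟨p, rfl⟩
    show S.bern he hVb hact hfull hinvi hirri hWi θ.symm.toLinearMap
      (S.bern he hVb hact hfull hinvj hirrj hWj θ.toLinearMap (S.R p.1.1 ((p.1.2 : Vb) : G → ℂ))) =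
        S.R p.1.1 ((p.1.2 : Vb) : G → ℂ)
    rw [S.bern_R he hVb hact hfull hinvj hirrj hWj θ.toLinearMap p.2,
      S.bern_R he hVb hact hfull hinvi hirri hWi θ.symm.toLinearMap p.2]
    show S.R p.1.1 ((θ.symm (θ p.1.2) : Vb) : G → ℂ) = S.R p.1.1 ((p.1.2 : Vb) : G → ℂ)
    rw [LinearEquiv.symm_apply_apply]
  · rw [S.bern_zero he hVb hact hfull hinvj hirrj hWj, S.bern_zero he hVb hact hfull hinvi hirri hWi]
  · intro x y hx hy hx' hy'
    have hxc : x ∈ S.core Wi := by rw [S.core_eq_span hVb Wi]; exact hx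
    have hyc : y ∈ S.core Wi := by rw [S.core_eq_span hVb Wi]; exact hy
    rw [S.bern_add he hVb hact hfull hinvj hirrj hWj θ.toLinearMap (hmemi hxc) (hmemi hyc),
      S.bern_add he hVb hact hfull hinvi hirri hWi θ.symm.toLinearMap
        (hmemj (S.bern_mem_core he hVb hact hfull hinvj hirrj hWj θ.toLinearMap (hmemi hxc)))
        (hmemj (S.bern_mem_core he hVb hact hfull hinvj hirrj hWj θ.toLinearMap (hmemi hyc))),
      hx', hy']
  · intro c x hx hx'
    have hxc : x ∈ S.core Wi := by rw [S.core_eq_span hVb Wi]; exact hx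
    rw [S.bern_smul he hVb hact hfull hinvj hirrj hWj θ.toLinearMap (hmemi hxc),
      S.bern_smul he hVb hact hfull hinvi hirri hWi θ.symm.toLinearMap
        (hmemj (S.bern_mem_core he hVb hact hfull hinvj hirrj hWj θ.toLinearMap (hmemi hxc))), hx']

include he hVb hact hfull hinvi hinvj hirrj hWi hWj in
/-- **the Bernstein maps of `θ` and `θ.symm` are mutually inverse isomorphisms of the cores**. -/
theorem isIsoRep_bern (hirri : S.IsIrreducible Vi) (θ : Wi ≃ₗ[H] Wj) :
    S.IsIsoRep (S.core Wi) (S.core Wj) (S.bern he hVb hact hfull hinvj hirrj hWj θ.toLinearMap)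
      (S.bern he hVb hact hfull hinvi hirri hWi θ.symm.toLinearMap) where
  toFun := S.isIntertwiner_bern he hVb hact hfull hinvi hinvj hirrj hWi hWj θ.toLinearMap
  invFun := S.isIntertwiner_bern he hVb hact hfull hinvj hinvi hirri hWj hWi θ.symm.toLinearMap
  left_inv ψ hψ := S.bern_symm_bern he hVb hact hfull hinvi hinvj hirrj hWi hWj hirri θ hψ
  right_inv ψ hψ := by
    have h := S.bern_symm_bern he hVb hact hfull hinvj hinvi hirri hWj hWi hirrj θ.symm hψ
    rwa [LinearEquiv.symm_symm] at h

include he hVb hact hfull hinvi hinvj hirrj hWi hWj in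
/-- **Bernstein on the cores**: an `H`-linear isomorphism of fixed blocks gives an isomorphism of representations
of the algebraic cores. -/
theorem isoRep_core_of_linearEquiv (hirri : S.IsIrreducible Vi) (θ : Wi ≃ₗ[H] Wj) :
    S.IsoRep (S.core Wi) (S.core Wj) :=
  ⟨_, _, S.isIsoRep_bern he hVb hact hfull hinvi hinvj hirrj hWi hWj hirri θ⟩

end Iso

section C2

variable {H : Type} [Ring H] {Vb : Submodule ℂ (G → ℂ)} [Module H Vb] {e : G → ℂ} {tst : H → G → ℂ}
  (he : IsTest e) (hVb : ∀ ψ : G → ℂ, ψ ∈ Vb ↔ S.Invariant ψ ∧ Continuous ψ ∧ S.R e ψ = ψ)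
  (hact : ∀ (r : H) (ψ : Vb), ((r • ψ : Vb) : G → ℂ) = S.R (tst r) ψ)
  (hfull : ∀ f : G → ℂ, IsTest f → ∃ r : H, ∀ ψ ∈ Vb, S.R e (S.R f ψ) = S.R (tst r) ψ)
  {ι : Type} {τ : ℕ → Set (G → ℂ)} (hinv : ∀ m, S.IsInvariantSubspace (τ m)) (hirr : ∀ m, S.IsIrreducible (τ m))
  {idx : ι → ℕ} {W : ι → Submodule H Vb} (hW : ∀ (i : ι) (ψ : Vb), ψ ∈ W i ↔ (ψ : G → ℂ) ∈ τ (idx i))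
  [SecondCountableTopology G] [T2Space G] [MeasurableMul G] [SFinite S.μ] [LocallyCompactSpace G]

include he hVb hact hfull hinv hirr hW in
/-- **the fixed-vector functor reflects isomorphism on the cores** of the displayed family. -/
theorem reflectsIso_core (i j : ι) (h : Nonempty ((W i) ≃ₗ[H] (W j))) :
    S.IsoRep (S.core (W i)) (S.core (W j)) :=
  S.isoRep_core_of_linearEquiv he hVb hact hfull (hinv _) (hinv _) (hirr _) (hW i) (hW j) (hirr _) h.some

include he hVb hact hfull hinv hirr hW in
/-- **(C2) from multiplicity one of the cores**: if the cores of distinct constituents of the block are not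
isomorphic representations, the fixed blocks are pairwise non-isomorphic `H`-modules — the field `hnon`. -/
theorem hnon_of_multiplicityOne_core (hM : ∀ i j : ι, i ≠ j → ¬ S.IsoRep (S.core (W i)) (S.core (W j))) :
    ∀ i j : ι, i ≠ j → IsEmpty ((W i) ≃ₗ[H] (W j)) :=
  fun i j hij => ⟨fun θ => hM i j hij (S.reflectsIso_core he hVb hact hfull hinv hirr hW i j ⟨θ⟩)⟩

end C2

end Setting

end RTF

end Summit.Ventures.HodgeRepro.Tier4.Line1

end
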